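import Mathlib
import HarnessLib.Audit
import Summits.PneNP.PneNP.Theorems.PstarFreshGate
import Summits.PneNP.PneNP.Theorems.PstarMaxSharingReaders
import Summits.PneNP.PneNP.Theorems.PstarCoreBoundTargets
import Summits.PneNP.PneNP.Theorems.PstarNorUnitRegime
import Summits.PneNP.PneNP.Theorems.PstarNorUnitAssembly

/-!
# Fresh gates on terminal cores: the raw-data form (ROUND-24, memo §10.1 / §13.2, O2; targets `TerminalFiveA` / `TerminalFiveMaxSharing`)

FRONTIER range-avoidance ladder, rung F-N3, ROUND 24 (cell `pnp-ideate`, planner memo `r24/CORE-BOUND-NOTES.md` §10.1 (gate-read family),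
§13.2 (maximal sharing); typed targets `PstarCoreBoundTargets.TerminalFiveA` / `TerminalFiveMaxSharing` (p646951); restricted-model proof
complexity — nothing here bears on `P` versus `NP`).

`PstarFreshGate.N_eq_singleton_of_freshGate` in the vocabulary of the typed targets (`PstarCoreBoundTargets.Terminal`):

* `sdiff_eq_singleton_of_freshGate` — a TERMINAL core `J₀` (T3 + M0 under two G-constraints `w₁, w₂`, `#J₀ < r`, monomials off the core) with a
  maximal leaf-peelable `F ⊆ J₀` whose co-edges are chords (Assumption A — automatic below twelve outputs, `assumptionA_of_terminal_lt_twelve`)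
  and whose readers avoid the co-edge privates EXCEPT for one fresh isolated gate `g₀ = (p, z)` on the co-edge `e₀` (`p` an AND variable of `e₀`,
  `z` outside every output of `J₀`, outside `C₁ ∪ C₂`, in no other reader): then `e₀` is the ONLY co-edge, `J₀ ∖ F = {e₀}`, and
* `eq_cycle_of_freshGate` — `J₀` is a single XOR cycle: `J₀ = D + e₀` for a fundamental set `D ⊆ F` with `D + e₀` everywhere even
  (`PstarNorUnitRegime.J₀_eq_of_single`);
* `sdiff_eq_singleton_of_maxSharing_gate` — at MAXIMAL SHARING (`2·#sharedSlots = #J₀`, memo §13.2) the freshness of the partner `z ∉ vars J₀` and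
  the absence of CROSS readers are automatic (`PstarMaxSharingReaders`), so only the isolation of `z` (`z ∉ C₁ ∪ C₂`, no second reader on `z`) and
  "no other private-touching reader" remain as hypotheses.

Not claimed: the size bound for the resulting single-cycle core (the single-chord endgame with a gate), non-isolated partners, several gates.
-/

set_option linter.dupNamespace false -- `Summit.PneNP.PneNP.…`: summit = sub-problem name (D-0017 single-conjunct layout)

open Finset Literature.Computability.Complexity
open Summit.PneNP.PneNP.Theorems.PstarTyped (Typed)
open Summit.PneNP.PneNP.Theorems.PstarSALevel (varSet bdry BoundaryExpanding SimpleOverlap)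
open Summit.PneNP.PneNP.Theorems.PstarGapOneAll (gval)
open Summit.PneNP.PneNP.Theorems.PstarCoreBound (XorClosed)
open Summit.PneNP.PneNP.Theorems.PstarChordRepair (IsChord)
open Summit.PneNP.PneNP.Theorems.PstarXCore (xverts)
open Summit.PneNP.PneNP.Theorems.PstarChordBridgeTools (privs mem_privs vars_mem_privs xpdeg)
open Summit.PneNP.PneNP.Theorems.PstarChordBridge
open Summit.PneNP.PneNP.Theorems.PstarChordBridgeCotree (Peelable)
open Summit.PneNP.PneNP.Theorems.PstarChordBridgeTerminal (HasConstraints)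
open Summit.PneNP.PneNP.Theorems.PstarChordBridgeAssemble (exists_bridgeData)
open Summit.PneNP.PneNP.Theorems.PstarSharingBound (sharedSlots)
open Summit.PneNP.PneNP.Theorems.PstarCoreBoundTargets (Terminal)
open Summit.PneNP.PneNP.Theorems.PstarFreshGateTools (FreshGate)
open Summit.PneNP.PneNP.Theorems.PstarFreshGate (N_eq_singleton_of_freshGate)
open Summit.PneNP.PneNP.Theorems.PstarMaxSharingReaders (readers_of_maxSharing_union)
open Summit.PneNP.PneNP.Theorems.PstarNorUnitRegime (J₀_eq_of_single)

namespace Summit.PneNP.PneNP.Theorems.PstarFreshGateTerminal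

variable {n m : ℕ}

/-- **A terminal core with a fresh isolated gate has exactly one co-edge.**  See the module docstring. -/
theorem sdiff_eq_singleton_of_freshGate (I : LocalMap 4 n m) (hI : I.IsPure xorAndPred) (hT : Typed I) (hS : SimpleOverlap I) {r : ℕ}
    (hB : BoundaryExpanding r I) {y : Fin m → Bool} {J₀ : Finset (Fin m)} {w₁ w₂ : Finset (Fin n) × Finset (Fin m) × Bool}
    (h : Terminal I r y J₀ w₁ w₂) {F : Finset (Fin m)} (hF : F ⊆ J₀) (hP : Peelable I F)
    (hmax : ∀ F', F ⊆ F' → F' ⊆ J₀ → Peelable I F' → F' = F) (hchord : ∀ e ∈ J₀ \ F, IsChord I J₀ e)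
    {e₀ g₀ : Fin m} {s₀ : Fin 4} {z : Fin n} (he₀ : e₀ ∈ J₀ \ F) (hs₀ : 2 ≤ s₀.val) (hg₀ : g₀ ∈ w₁.2.1 ∪ w₂.2.1)
    (hpair : (I.vars g₀ 2 = I.vars e₀ s₀ ∧ I.vars g₀ 3 = z) ∨ (I.vars g₀ 2 = z ∧ I.vars g₀ 3 = I.vars e₀ s₀))
    (hzJ : ∀ j ∈ J₀, z ∉ varSet I j) (hzC : z ∉ w₁.1 ∧ z ∉ w₂.1)
    (hzG : ∀ g ∈ w₁.2.1 ∪ w₂.2.1, g ≠ g₀ → I.vars g 2 ≠ z ∧ I.vars g 3 ≠ z)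
    (hun : ∀ g ∈ w₁.2.1 ∪ w₂.2.1, g ≠ g₀ → ∀ v ∈ privs I (J₀ \ F), I.vars g 2 ≠ v ∧ I.vars g 3 ≠ v) : J₀ \ F = {e₀} := by
  classical
  obtain ⟨hne, hX, hJr, hG₁, hG₂, hr, hT3, hM0⟩ := h
  -- no CROSS reader: the gate's partner is outside the core, the other readers avoid the privates
  have hzp : z ∉ privs I (J₀ \ F) := by
    rw [mem_privs]
    rintro ⟨e, he, hz | hz⟩
    · exact hzJ e (mem_sdiff.1 he).1 (hz ▸ PstarCentreFree.vars_mem_varSet I e 2)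
    · exact hzJ e (mem_sdiff.1 he).1 (hz ▸ PstarCentreFree.vars_mem_varSet I e 3)
  have hcross : ∀ g ∈ w₁.2.1 ∪ w₂.2.1, ¬ (I.vars g 2 ∈ privs I (J₀ \ F) ∧ I.vars g 3 ∈ privs I (J₀ \ F)) := by
    intro g hg ⟨h2, h3⟩
    by_cases hgg : g = g₀
    · subst hgg
      rcases hpair with ⟨-, h3z⟩ | ⟨h2z, -⟩
      · exact hzp (h3z ▸ h3)
      · exact hzp (h2z ▸ h2)
    · exact (hun g hg hgg _ h2).1 rfl
  obtain ⟨B, hy, hJ, hN, ⟨h1, h2, h3, h4, h5, h6⟩, hW, hL, -, -⟩ :=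
    exists_bridgeData I hI hT hS hB y hne hJr.le w₁ w₂ hG₁ hG₂ hT3 hM0 hF hP hmax hchord hcross
  have hsol : ∀ K zz, Solution I B K zz ↔
      (∀ j ∈ K, I.eval zz j = y j) ∧ gval I w₁.1 w₁.2.1 zz = w₁.2.2 ∧ gval I w₂.1 w₂.2.1 zz = w₂.2.2 := by
    intro K zz; unfold Solution; rw [hy, h1, h2, h3, h4, h5, h6]
  have hfg : FreshGate I B e₀ g₀ s₀ z :=
    { he₀ := by rw [hN]; exact he₀
      hs₀ := hs₀
      hg₀ := by rw [h2, h5]; exact hg₀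
      hpair := hpair
      hzJ := by rw [hJ]; exact hzJ
      hzC := by rw [h1, h4]; exact hzC
      hzG := by rw [h2, h5]; exact hzG
      hun := by rw [h2, h5, hN]; exact hun }
  rw [← hN]
  refine N_eq_singleton_of_freshGate I hI hT hS hB hW (by rw [hJ]; exact hJr.le) (by rw [h2, hJ]; exact hG₁.symm)
    (by rw [h5, hJ]; exact hG₂.symm) hL ?_ (fun e he => ?_) hfg
  · rintro ⟨zz, hzz⟩
    rw [hJ] at hzz
    exact hT3 ⟨zz, (hsol J₀ zz).1 hzz⟩
  · obtain ⟨zz, hzz⟩ := hM0 e (by rw [hN] at he; exact (mem_sdiff.1 he).1)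
    exact ⟨zz, by rw [hJ]; exact (hsol _ zz).2 hzz⟩

/-- **… and the core is one XOR cycle**: `J₀ = D + e₀` with `D ⊆ F`, `e₀ ∉ D` and `D + e₀` everywhere even in the XOR multigraph. -/
theorem eq_cycle_of_freshGate (I : LocalMap 4 n m) (hI : I.IsPure xorAndPred) (hT : Typed I) (hS : SimpleOverlap I) {r : ℕ}
    (hB : BoundaryExpanding r I) {y : Fin m → Bool} {J₀ : Finset (Fin m)} {w₁ w₂ : Finset (Fin n) × Finset (Fin m) × Bool}
    (h : Terminal I r y J₀ w₁ w₂) {F : Finset (Fin m)} (hF : F ⊆ J₀) (hP : Peelable I F)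
    (hmax : ∀ F', F ⊆ F' → F' ⊆ J₀ → Peelable I F' → F' = F) (hchord : ∀ e ∈ J₀ \ F, IsChord I J₀ e)
    {e₀ g₀ : Fin m} {s₀ : Fin 4} {z : Fin n} (he₀ : e₀ ∈ J₀ \ F) (hs₀ : 2 ≤ s₀.val) (hg₀ : g₀ ∈ w₁.2.1 ∪ w₂.2.1)
    (hpair : (I.vars g₀ 2 = I.vars e₀ s₀ ∧ I.vars g₀ 3 = z) ∨ (I.vars g₀ 2 = z ∧ I.vars g₀ 3 = I.vars e₀ s₀))
    (hzJ : ∀ j ∈ J₀, z ∉ varSet I j) (hzC : z ∉ w₁.1 ∧ z ∉ w₂.1)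
    (hzG : ∀ g ∈ w₁.2.1 ∪ w₂.2.1, g ≠ g₀ → I.vars g 2 ≠ z ∧ I.vars g 3 ≠ z)
    (hun : ∀ g ∈ w₁.2.1 ∪ w₂.2.1, g ≠ g₀ → ∀ v ∈ privs I (J₀ \ F), I.vars g 2 ≠ v ∧ I.vars g 3 ≠ v) :
    F = J₀.erase e₀ ∧ ∃ D ⊆ F, e₀ ∉ D ∧ (∀ w, Even (xpdeg I (insert e₀ D) w)) ∧ J₀ = insert e₀ D := by
  classical
  have hsd := sdiff_eq_singleton_of_freshGate I hI hT hS hB h hF hP hmax hchord he₀ hs₀ hg₀ hpair hzJ hzC hzG hun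
  have hFJ : F = J₀.erase e₀ := by
    rw [← sdiff_singleton_eq_erase, ← hsd, Finset.sdiff_sdiff_eq_self hF]
  obtain ⟨D, hD, heD, hev⟩ := PstarChordBridgeCotree.exists_fundamental_of_maximal I hI hF hP hmax he₀
  refine ⟨hFJ, D, hD, heD, hev, ?_⟩
  -- the single-chord bridge data `{e₀}` with fundamental set `D`
  let B : BridgeData n m :=
    { y := y, J₀ := J₀, N := {e₀}, D := fun _ => D, C₁ := ∅, G₁ := ∅, b₁ := false, T₁ := ∅, C₂ := ∅, G₂ := ∅, b₂ := false, T₂ := ∅ }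
  have hNF : B.J₀ \ B.N = F := by
    show J₀ \ {e₀} = F
    rw [sdiff_singleton_eq_erase, hFJ]
  have hX : XorClosed I J₀ := h.2.1
  have hW : B.WF I :=
    { hN := by
        show ({e₀} : Finset (Fin m)) ⊆ J₀
        exact singleton_subset_iff.2 (mem_sdiff.1 he₀).1
      hchord := fun e he => by
        have : e = e₀ := mem_singleton.1 he
        subst this; exact hchord e he₀
      hD := fun e _ => by rw [hNF]; exact hD
      hDeven := fun e he w => by
        have : e = e₀ := mem_singleton.1 he
        subst this; exact hev w
      hT₁ := fun j hj => absurd hj (notMem_empty j)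
      hT₂ := fun j hj => absurd hj (notMem_empty j)
      hjoin₁ := fun w => by
        show Odd (xpdeg I ∅ w) ↔ w ∈ (∅ : Finset (Fin n)) ∧ _
        rw [PstarNorUnitAssembly.xpdeg_empty]
        exact ⟨fun h0 => absurd h0 (by decide), fun h0 => absurd h0.1 (notMem_empty w)⟩
      hjoin₂ := fun w => by
        show Odd (xpdeg I ∅ w) ↔ w ∈ (∅ : Finset (Fin n)) ∧ _
        rw [PstarNorUnitAssembly.xpdeg_empty]
        exact ⟨fun h0 => absurd h0 (by decide), fun h0 => absurd h0.1 (notMem_empty w)⟩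
      hcross₁ := fun g hg => absurd hg (notMem_empty g)
      hcross₂ := fun g hg => absurd hg (notMem_empty g) }
  have hPF : Peelable I (B.J₀ \ B.N) := by rw [hNF]; exact hP
  exact J₀_eq_of_single I hI hT hW hX hPF rfl

/-- **At maximal sharing the gate's freshness is automatic.**  Terminal core with `2·#sharedSlots = #J₀`, Assumption A data, one reader `g₀` on a
co-edge private whose partner `z` is isolated (`z ∉ C₁ ∪ C₂`, in no other reader), no other reader on a co-edge private: `J₀ ∖ F = {e₀}`. -/
theorem sdiff_eq_singleton_of_maxSharing_gate (I : LocalMap 4 n m) (hI : I.IsPure xorAndPred) (hT : Typed I) (hS : SimpleOverlap I) {r : ℕ}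
    (hB : BoundaryExpanding r I) {y : Fin m → Bool} {J₀ : Finset (Fin m)} {w₁ w₂ : Finset (Fin n) × Finset (Fin m) × Bool}
    (h : Terminal I r y J₀ w₁ w₂) (hms : 2 * (sharedSlots I J₀).card = J₀.card) {F : Finset (Fin m)} (hF : F ⊆ J₀) (hP : Peelable I F)
    (hmax : ∀ F', F ⊆ F' → F' ⊆ J₀ → Peelable I F' → F' = F) (hchord : ∀ e ∈ J₀ \ F, IsChord I J₀ e)
    {e₀ g₀ : Fin m} {s₀ : Fin 4} (he₀ : e₀ ∈ J₀ \ F) (hs₀ : 2 ≤ s₀.val) (hg₀ : g₀ ∈ w₁.2.1 ∪ w₂.2.1) {t₀ t₁ : Fin 4} (ht₀ : 2 ≤ t₀.val) (ht₁ : 2 ≤ t₁.val) (htt : t₀ ≠ t₁)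
    (hgp : I.vars g₀ t₀ = I.vars e₀ s₀)
    (hzC : I.vars g₀ t₁ ∉ w₁.1 ∧ I.vars g₀ t₁ ∉ w₂.1)
    (hzG : ∀ g ∈ w₁.2.1 ∪ w₂.2.1, g ≠ g₀ → I.vars g 2 ≠ I.vars g₀ t₁ ∧ I.vars g 3 ≠ I.vars g₀ t₁)
    (hun : ∀ g ∈ w₁.2.1 ∪ w₂.2.1, g ≠ g₀ → ∀ v ∈ privs I (J₀ \ F), I.vars g 2 ≠ v ∧ I.vars g 3 ≠ v) : J₀ \ F = {e₀} := by
  classical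
  -- the partner is fresh by the counting of `PstarMaxSharingReaders`
  obtain ⟨-, -, hfresh⟩ := readers_of_maxSharing_union I hB h.2.1 hms hchord h.2.2.2.1.symm h.2.2.2.2.1.symm h.2.2.2.2.2.1
  have hp : I.vars g₀ t₀ ∈ privs I (J₀ \ F) := hgp ▸ vars_mem_privs I he₀ hs₀
  have hzJ : ∀ j ∈ J₀, I.vars g₀ t₁ ∉ varSet I j := hfresh g₀ hg₀ t₀ t₁ ht₀ ht₁ htt hp
  have hpair : (I.vars g₀ 2 = I.vars e₀ s₀ ∧ I.vars g₀ 3 = I.vars g₀ t₁) ∨ (I.vars g₀ 2 = I.vars g₀ t₁ ∧ I.vars g₀ 3 = I.vars e₀ s₀) := by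
    rcases PstarMaxSharingReaders.and_slots ht₀ ht₁ htt with ⟨h0, h1⟩ | ⟨h0, h1⟩ <;> subst h0 <;> subst h1
    · exact Or.inl ⟨hgp, rfl⟩
    · exact Or.inr ⟨rfl, hgp⟩
  exact sdiff_eq_singleton_of_freshGate I hI hT hS hB h hF hP hmax hchord he₀ hs₀ hg₀ hpair hzJ hzC hzG hun

end Summit.PneNP.PneNP.Theorems.PstarFreshGateTerminal
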